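import Summits.QuantumFields.YangMills.Theorems.BalabanUVNodesN19RekeyingAbsorptionClassForm
import Summits.QuantumFields.YangMills.Theorems.BalabanUVNodesN19HybridBeyondTarget

/-!
# BalabanUVNodes ∕ node N19 (NE7) — THE FLAGGED WINDOW DATUM: an explicit window-key reading with TWO good classes (old mismatch absorbed, young matched at rate `u_K`) and ONE
# flagged class of small weight `2W_K` whose two-run ratio `M_K ∈ (0,1]` is NOT matched — `Core` with EMPTY bad class FAILS (gap `≥ log 2`), the complete law-merge binder list
# `HybridNE7 … {flag} W 0 0 0 (u∕vol)` HOLDS (p613310 `hybridNE7_of_classFactorisation` BY NAME): the A2 inhabitant of the class form with a NON-EMPTY flag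

Cell `pub-ymgap` (HUMAN RULING D-0062 Track A ∕ D-0149 width seats), WIDTH SEAT `pub-ymgap-dag-n19-w1` (node n19 = NE7, seat 1 of 3), generation g4, INTENT-5.  Route
`Summits/QuantumFields/YangMills/Theses/BalabanUVNodes.lean`, key item K3⁷ `SpineGivenEndpointR13SepCoPH` (stmt-QuantumFields-20544; v5 stub 2 `stub_expansion13H`, conjuncts N19′ ∧ N20);
filed `--kind proof --supports … --as helper`.  COUNT-NEUTRAL.  THEOREMS ONLY (0 `def`, 0 `sorry`).  ADDITIVE — imports this seat's g4 `…Theorems.BalabanUVNodesN19RekeyingAbsorptionClassForm`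
(p613310: `core_of_classFactorisation`, `hybridNE7_of_classFactorisation`) and g3 `…Theorems.BalabanUVNodesN19HybridBeyondTarget` (p602850: `not_coreEdge_of_unsummable_gap`); through them
the tree's `Spine/NE7/Targets` (`Core`), `T4MatchingAssembly` (`HybridNE7`), `T4WeightBudget` (`RelWeightBound`); modifies nothing.

WHY.  p613310 states the complete law-merge binder list «(Y) + (D) on the good classes + NE7b on the flagged classes» with the flag as a HYPOTHESIS slot; p612537's datum has an EMPTY
flag.  A6∕A2 hygiene (START-LIST §n19 (2′)'s standard: non-degenerate inhabitants with NON-EMPTY `Bad`) asks for a reading where the flag is NEEDED and PAID: THIS FILE.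
THE DATUM at level `K` (letters `κ_K > 0`, `u_K ≥ 0`, `0 ≤ W_K < 1` summable, `0 < M_K ≤ 1`): classes `Option Bool` at the WINDOW key (old structure already summed out).
Good classes `some y`: run A `2·k̄(y)` (`k̄(false) = 1`, `k̄(true) = κ_K`; the `2` = a saturated uniform old law's mass), run B `4·k̄′(y)` (`k̄′(true) = κ_K e^{u_K}`; the `4 = 1 + 3` =
the old law MISMATCHED by the factor `3`, absorbed).  Flagged class `none` («a pending old region visible in the window»): run A `2W_K`, run B `2W_K·M_K` — its two-run ratio `M_K`
is NOT matched to the good classes' (`2·e^{0 or u}`).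
* §1 [folklore] `sum_A` ∕ `sum_B` (totals) · ★ `relWeightBound_flag` (the flagged class has relative weight `≤ W_K` in BOTH runs: `2W ≤ W·(2W + 2(1+κ))` needs `W ≤ … `— we use
  `2W_K ≤ W_K·Σ` ⇐ `2 ≤ Σ∕…`; see the statement: it holds because the good mass is `≥ 2` resp. `≥ 4` and `M ≤ 1`).
* §2 [folklore] ★★ `core_goodClasses` (p613310 `core_of_classFactorisation` BY NAME with `s ≡ 0`, `R_A = 2`, `R_B = 4`, `r = u∕vol`: `Core … {none} A B (u∕vol + 0)`) ·
  ★★★ `hybridNE7_flagged` (`HybridNE7 l₀ vol univ A B {none} W 0 0 0 (K ↦ u_K∕vol + 0)` — p613310 `hybridNE7_of_classFactorisation` BY NAME).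
* §3 [folklore] ★★ `not_coreEdge_unflagged` (with EMPTY bad class NO summable `Core`: the flagged class's log-ratio `log M_K ≤ 0` sits `≥ log 2` below the good class `some false`'s
  `log 2` — g3's `not_coreEdge_of_unsummable_gap` BY NAME).  The flag is NECESSARY and, paid by N20's face, SUFFICIENT.
READING (located; nothing proposed).  At a window key the N19′ ∧ N20 pair of stub 2 is genuinely HYBRID: the flagged («old AND pending») classes are where N20 has content, the good
classes are where absorption + young matching give `Core`; neither face alone serves this datum.  Nothing here is Bałaban's.

HONEST FRAMING.  One explicit finite datum (letters `κ, u, W, M` free sequences) + [folklore] finite-sum ∕ real arithmetic over the tree's SHAPES (`Core`, `RelWeightBound`, `HybridNE7`);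
nothing of Bałaban's is asserted or instantiated; no estimate of the programme is proved.  NE7 ∕ NE7b NOT PRINTED as two-run statements for d = 4 ∕ NOT proved; N19 ∕ N20 NOT
discharged; K3⁷ OPEN, not claimed, v5 untouched; counts UNMOVED (typed 28∕28 · discharged 5∕27, A 5∕28).  Everything below is PROVED (0 `sorry`, 0 named facts, standard axioms); no
decl carries a cite tag.  One finite four-torus programme at fixed ε — NOT ℝ⁴, NOT infinite volume, NOT OS, NOT a mass gap, NOT the Clay problem (R4 closes the conditional finite-𝕋⁴
rung `BalabanLadder.UV` only).
-/

noncomputable section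

open Finset
open scoped BigOperators

namespace Summit.QuantumFields.YangMills.BalabanUVNodes.N19FlaggedWindowDatum

open Summit.QuantumFields.BalabanUV.T4Continuum.Spine.NE7 (Core)
open Literature.MathematicalPhysics.QuantumFieldTheory.Balaban1983to89
open T4WeightBudget (RelWeightBound)
open T4MatchingAssembly (HybridNE7)
open Summit.QuantumFields.YangMills.BalabanUVNodes.N19RekeyingAbsorptionClassForm (core_of_classFactorisation hybridNE7_of_classFactorisation)
open Summit.QuantumFields.YangMills.BalabanUVNodes.N19HybridBeyondTarget (not_coreEdge_of_unsummable_gap)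

variable {κ u W M : ℕ → ℝ}

/-! ## §1 The datum's totals and the flagged class's relative weight [folklore] -/

/-- Run A's total at level `K`: `2W_K + 2 + 2κ_K`. [folklore] -/
theorem sum_A (K : ℕ) :
    ∑ τ ∈ (Finset.univ : Finset (Option Bool)), (Option.elim τ (2 * W K) fun y => 2 * (if y then κ K else 1)) = 2 * W K + 2 + 2 * κ K := by
  rw [Fintype.sum_option, Fintype.sum_bool]
  simp only [Option.elim, if_true, Bool.false_eq_true, if_false]
  ring

/-- Run B's total at level `K`: `2W_K M_K + 4 + 4κ_K e^{u_K}`. [folklore] -/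
theorem sum_B (K : ℕ) :
    ∑ τ ∈ (Finset.univ : Finset (Option Bool)), (Option.elim τ (2 * W K * M K) fun y => 4 * (if y then κ K * Real.exp (u K) else 1))
      = 2 * W K * M K + 4 + 4 * (κ K * Real.exp (u K)) := by
  rw [Fintype.sum_option, Fintype.sum_bool]
  simp only [Option.elim, if_true, Bool.false_eq_true, if_false]
  ring

/-- **★ N20's FACE FOR THE FLAGGED CLASS** [folklore]: with `0 ≤ W_K < 1` summable, `κ_K > 0`, `0 < M_K ≤ 1`, the flagged class `{none}` has relative weight `≤ W_K` in both runs
(`2W ≤ W·(2W + 2 + 2κ)` since `W ≤ 1 ≤ 1 + κ`; `2WM ≤ W·(2WM + 4 + …)` since `M ≤ 1 < 2`): `RelWeightBound l₀ univ A B {none} W`. -/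
theorem relWeightBound_flag {l₀ : ℝ} (hκ : ∀ K, 0 < κ K) (hW0 : ∀ K, 0 ≤ W K) (hW1 : ∀ K, W K < 1) (hWs : Summable W)
    (hM0 : ∀ K, 0 < M K) (hM1 : ∀ K, M K ≤ 1) :
    RelWeightBound l₀ (fun _ => (Finset.univ : Finset (Option Bool)))
      (fun K _ τ => Option.elim τ (2 * W K) fun y => 2 * (if y then κ K else 1))
      (fun K _ τ => Option.elim τ (2 * W K * M K) fun y => 4 * (if y then κ K * Real.exp (u K) else 1))
      (fun _ _ => ({none} : Finset (Option Bool))) W where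
  bad_subset _ _ _ := Finset.subset_univ _
  nonneg := hW0
  lt_one := hW1
  summable := hWs
  bad_left K t _ := by
    rw [Finset.sum_singleton, sum_A]
    simp only [Option.elim]
    have := hκ K; have := hW0 K; have := hW1 K
    nlinarith
  bad_right K t _ := by
    rw [Finset.sum_singleton, sum_B]
    simp only [Option.elim]
    have := hκ K; have := hW0 K; have := hW1 K; have := hM0 K; have := hM1 K
    have : 0 < κ K * Real.exp (u K) := mul_pos (hκ K) (Real.exp_pos _)
    nlinarith [mul_nonneg (hW0 K) (hM0 K).le]

/-! ## §2 The good classes: class form, `Core`, and the complete binder list [folklore] -/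

/-- The YOUNG class factors of the datum match modulo constants at radius `u_K` (constant `0`; the flagged class's factor is `0` on both sides). [folklore] -/
theorem core_youngFactors {l₀ vol : ℝ} (hvol : 0 < vol) (hκ : ∀ K, 0 < κ K) (hu : ∀ K, 0 ≤ u K) :
    Core l₀ vol (fun _ => (Finset.univ : Finset (Option Bool))) (fun _ _ => ({none} : Finset (Option Bool)))
      (fun K (_ : ℝ) τ => Option.elim τ (0 : ℝ) fun y => if y then κ K else 1)
      (fun K (_ : ℝ) τ => Option.elim τ (0 : ℝ) fun y => if y then κ K * Real.exp (u K) else 1) (fun K => u K / vol) := by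
  intro K
  refine ⟨0, fun t _ τ hτ => ?_⟩
  obtain ⟨y, rfl⟩ : ∃ y, τ = some y := by
    rcases τ with _ | y
    · simp at hτ
    · exact ⟨y, rfl⟩
  have hr : vol * (u K / vol) = u K := mul_div_cancel₀ _ hvol.ne'
  rw [hr, zero_sub, zero_add]
  have hu0 := hu K
  have hk := hκ K
  cases y
  · simp only [Option.elim, Bool.false_eq_true, if_false, mul_one]
    exact ⟨Real.exp_le_one_iff.mpr (by linarith), Real.one_le_exp (by linarith)⟩
  · simp only [Option.elim, if_true]
    constructor
    · rw [mul_comm]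
      exact mul_le_mul_of_nonneg_left (Real.exp_le_exp.mpr (by linarith)) hk.le
    · rw [mul_comm]

/-- **★★ `Core` ON THE GOOD CLASSES** [folklore] (p613310 `core_of_classFactorisation` BY NAME, `s ≡ 0`, class factors `k̄ = (κ ∣ 1)`, `k̄′ = (κe^u ∣ 1)`, old scalars `R_A = 2`, `R_B = 4`
— their ratio `2`, the absorbed old mismatch, goes to the constant): `Core l₀ vol univ {none} A B (K ↦ u_K∕vol + (0+0)∕vol)`. -/
theorem core_goodClasses {l₀ vol : ℝ} (hvol : 0 < vol) (hκ : ∀ K, 0 < κ K) (hu : ∀ K, 0 ≤ u K) :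
    Core l₀ vol (fun _ => (Finset.univ : Finset (Option Bool))) (fun _ _ => ({none} : Finset (Option Bool)))
      (fun K _ τ => Option.elim τ (2 * W K) fun y => 2 * (if y then κ K else 1))
      (fun K _ τ => Option.elim τ (2 * W K * M K) fun y => 4 * (if y then κ K * Real.exp (u K) else 1))
      (fun K => u K / vol + ((0 : ℝ) + 0) / vol) := by
  refine core_of_classFactorisation (mA := fun K _ τ => Option.elim τ 0 fun y => if y then κ K else 1)
    (mB := fun K _ τ => Option.elim τ 0 fun y => if y then κ K * Real.exp (u K) else 1)
    (sA := fun _ _ _ => 0) (sB := fun _ _ _ => 0) (RA := fun _ => 2) (RB := fun _ => 4) (SA := fun _ => 0) (SB := fun _ => 0) (r := fun K => u K / vol)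
    hvol ?_ ?_ (fun _ _ _ _ _ => ⟨le_rfl, le_rfl⟩) ?_ (fun _ => by norm_num) (fun _ => by norm_num) (core_youngFactors hvol hκ hu)
  · -- run A on the good classes: `2·k̄(y) = e^{0}·k̄(y)·2`
    intro K t _ τ hτ
    obtain ⟨y, rfl⟩ : ∃ y, τ = some y := by
      rcases τ with _ | y
      · simp at hτ
      · exact ⟨y, rfl⟩
    simp only [Option.elim, neg_zero, Real.exp_zero, one_mul]
    constructor <;> linarith
  · intro K t _ τ hτ
    obtain ⟨y, rfl⟩ : ∃ y, τ = some y := by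
      rcases τ with _ | y
      · simp at hτ
      · exact ⟨y, rfl⟩
    simp only [Option.elim, neg_zero, Real.exp_zero, one_mul]
    constructor <;> linarith
  · intro K t _ τ _
    rcases τ with _ | y
    · simp
    · simp only [Option.elim]
      split_ifs
      · exact (hκ K).le
      · exact zero_le_one

/-- **★★★ THE COMPLETE LAW-MERGE BINDER LIST WITH A NON-EMPTY FLAG** [folklore]: `HybridNE7 l₀ vol univ A B {none} W 0 0 0 (K ↦ u_K∕vol + 0∕vol)` for the datum — N20 pays the flagged
class (`relWeightBound_flag`), absorption + young matching give `Core` on the good classes (`core_goodClasses`), `u` summable — p613310 `hybridNE7_of_classFactorisation` BY NAME. -/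
theorem hybridNE7_flagged {l₀ vol : ℝ} (hvol : 0 < vol) (hκ : ∀ K, 0 < κ K) (hu0 : ∀ K, 0 ≤ u K) (hu : Summable u)
    (hW0 : ∀ K, 0 ≤ W K) (hW1 : ∀ K, W K < 1) (hWs : Summable W) (hM0 : ∀ K, 0 < M K) (hM1 : ∀ K, M K ≤ 1) :
    HybridNE7 l₀ vol (fun _ => (Finset.univ : Finset (Option Bool)))
      (fun K _ τ => Option.elim τ (2 * W K) fun y => 2 * (if y then κ K else 1))
      (fun K _ τ => Option.elim τ (2 * W K * M K) fun y => 4 * (if y then κ K * Real.exp (u K) else 1))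
      (fun _ _ => ({none} : Finset (Option Bool))) W (fun _ _ _ => 0) (fun _ _ _ => 0) (fun _ => 0)
      (fun K => u K / vol + ((0 : ℝ) + 0) / vol) := by
  refine hybridNE7_of_classFactorisation (mA := fun K _ τ => Option.elim τ 0 fun y => if y then κ K else 1)
    (mB := fun K _ τ => Option.elim τ 0 fun y => if y then κ K * Real.exp (u K) else 1)
    (sA := fun _ _ _ => 0) (sB := fun _ _ _ => 0) (RA := fun _ => 2) (RB := fun _ => 4) (SA := fun _ => 0) (SB := fun _ => 0) (r := fun K => u K / vol)
    hvol ?_ ?_ (fun _ _ _ _ _ => ⟨le_rfl, le_rfl⟩) ?_ (fun _ => by norm_num) (fun _ => by norm_num) (core_youngFactors hvol hκ hu0)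
    (relWeightBound_flag hκ hW0 hW1 hWs hM0 hM1) ?_ ?_ (by simpa using hu.div_const vol)
  · intro K t _ τ hτ
    obtain ⟨y, rfl⟩ : ∃ y, τ = some y := by
      rcases τ with _ | y
      · simp at hτ
      · exact ⟨y, rfl⟩
    simp only [Option.elim, neg_zero, Real.exp_zero, one_mul]
    constructor <;> linarith
  · intro K t _ τ hτ
    obtain ⟨y, rfl⟩ : ∃ y, τ = some y := by
      rcases τ with _ | y
      · simp at hτ
      · exact ⟨y, rfl⟩
    simp only [Option.elim, neg_zero, Real.exp_zero, one_mul]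
    constructor <;> linarith
  · intro K t _ τ _
    rcases τ with _ | y
    · simp
    · simp only [Option.elim]
      split_ifs
      · exact (hκ K).le
      · exact zero_le_one
  · intro K t _ τ _
    have := hκ K; have := hW0 K
    rcases τ with _ | y
    · simp only [Option.elim]; positivity
    · simp only [Option.elim]; split_ifs <;> positivity
  · intro K t _ τ _
    have := hκ K; have := hW0 K; have := hM0 K
    rcases τ with _ | y
    · simp only [Option.elim]; positivity
    · simp only [Option.elim]; split_ifs <;> positivity

/-! ## §3 Without the flag there is no summable `Core` [folklore] -/

/-- **★★ THE FLAG IS NECESSARY** [folklore]: the SAME datum with an EMPTY bad class admits NO `δ` with `Core … ∅ A B δ ∧ Summable δ` (`κ > 0`, `0 < W`, `0 < M ≤ 1`, any `u`, any `l₀ ≥ 0`,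
`vol`): the good class `some false` has two-run ratio `2`, the flagged class `M_K ≤ 1` — a log-ratio gap `≥ log 2` at every level (g3's `not_coreEdge_of_unsummable_gap` BY NAME). -/
theorem not_coreEdge_unflagged {l₀ vol : ℝ} (hl₀ : 0 ≤ l₀) (hW : ∀ K, 0 < W K) (hM0 : ∀ K, 0 < M K) (hM1 : ∀ K, M K ≤ 1) :
    ¬ ∃ δ : ℕ → ℝ, Core l₀ vol (fun _ => (Finset.univ : Finset (Option Bool))) (fun _ _ => (∅ : Finset (Option Bool)))
        (fun K _ τ => Option.elim τ (2 * W K) fun y => 2 * (if y then κ K else 1))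
        (fun K _ τ => Option.elim τ (2 * W K * M K) fun y => 4 * (if y then κ K * Real.exp (u K) else 1)) δ ∧
      Summable δ := by
  have hlog2 : 0 < Real.log 2 := Real.log_pos (by norm_num)
  refine not_coreEdge_of_unsummable_gap (g := fun _ => Real.log 2) (fun _ => hlog2.le) ?_ fun K => ?_
  · intro hs
    exact hlog2.ne' (tendsto_nhds_unique tendsto_const_nhds hs.tendsto_atTop_zero)
  · refine ⟨0, by simpa using hl₀, some false, by simp, none, by simp, ?_, ?_, ?_⟩
    · simp only [Option.elim, Bool.false_eq_true, if_false]; norm_num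
    · simp only [Option.elim]; linarith [hW K]
    · simp only [Option.elim, Bool.false_eq_true, if_false, mul_one]
      have hWK := hW K
      have hMK := hM0 K
      -- `(log 4 − log 2) − (log (2WM) − log (2W)) = log 2 − log M ≥ log 2`
      have h1 : Real.log (4 : ℝ) - Real.log 2 = Real.log 2 := by
        rw [← Real.log_div (by norm_num) (by norm_num)]; norm_num
      have h2 : Real.log (2 * W K * M K) - Real.log (2 * W K) = Real.log (M K) := by
        rw [← Real.log_div (by positivity) (by positivity), mul_div_cancel_left₀ _ (by positivity)]
      rw [h1, h2]
      linarith [Real.log_nonpos (hM0 K).le (hM1 K)]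

end Summit.QuantumFields.YangMills.BalabanUVNodes.N19FlaggedWindowDatum
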